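import Literature.Geometry.Lorentzian.GeodesicMaximalFlow
import Literature.Geometry.Riemannian.GeodesicFlowSmooth
import HarnessLib

/-!
# A geodesic on an open interval is determined by the limit of its tangent lift at an endpoint

For a `C¹` covariant derivative `cov` on the tangent bundle of a Hausdorff manifold `M` without
boundary (finite-dimensional complete model), in the framework of
`Literature.Geometry.Lorentzian.Geodesic` (geodesics `γ` of `cov` on parameter sets,
`tangentLift I γ t = (γ t, γ' t) ∈ TM`) and of the maximal geodesics
`γ_p = Literature.Geometry.Riemannian.maximalGeodesic cov x v`, `p = (x, v)`
(`ExponentialMap.lean`), we prove the **one-sided uniqueness of geodesics from limiting initial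
data**: if `γ` is a geodesic on the OPEN interval `(0, b)` whose tangent lift converges to
`p₀ ∈ TM` as `t → 0⁺`, and `(0, b)` lies in the domain of `γ_{p₀}`, then `γ = γ_{p₀}` on `(0, b)`
(`IsGeodesicOn.eqOn_maximalGeodesic_of_tendsto_tangentLift`); if moreover `γ` is continuous from
the left at `b` and `b` is in the domain of `γ_{p₀}`, then also `γ b = γ_{p₀} b`
(`IsGeodesicOn.apply_eq_maximalGeodesic_of_tendsto_tangentLift`). Nothing is assumed about `γ`
AT the parameter `0` (where the one-sided uniqueness of `GeodesicOneSidedUniqueness.lean`,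
`IsGeodesicOn.eqOn_Icc_of_velocity_eq`, would need the geodesic condition): the statement is the
standard consequence of the continuous dependence of solutions of the geodesic equation on their
initial data (O'Neill 1983, Ch. 3, Lemma 22 and the remark before Prop. 28, p. 70; Lee 2018,
Thm. 4.27 (d)): for `0 < θ < t₀ < b` the geodesic `γ` is the maximal geodesic through its own
tangent lift `p_θ = (γ θ, γ' θ)` (`subset_maximalGeodesicDomain_of_isGeodesicOn` for the
translate `t ↦ γ (t + θ)`), so `(γ t₀, γ' t₀) = Θ(p_θ, t₀ - θ)` with `Θ(p, t) = (γ_p t, γ_p' t)`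
the maximal geodesic flow; as `θ → 0⁺`, `(p_θ, t₀ - θ) → (p₀, t₀)` inside the open flow domain,
on which `Θ` is continuous (`isOpen_continuousOn_tangentLift_maximalGeodesic`,
`GeodesicMaximalFlow.lean`), whence `(γ t₀, γ' t₀) = Θ(p₀, t₀)`.

This is the form of geodesic uniqueness used when an isometric immersion `ψ` of an open set `U`
is compared, along a geodesic issuing from a boundary point `s ∈ ∂U`, with a map known only to
extend `ψ` smoothly across `s` (Sbierski 2016, §3.2, proof of Thm. 12: "`ψ = φ` in `N ∩ Ū`"):
`ψ ∘ γ` is a geodesic for positive parameters only, but its tangent lift has a limit at `0`.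

Everything is proved; no definitions, no named facts (D-0026).

## References

* B. O'Neill, *Semi-Riemannian geometry with applications to relativity*, Academic Press 1983,
  Ch. 3, Lemma 22 (p. 68) and the remark before Prop. 28 (p. 70). [ONeillSemiRiemannian1983]
* J. M. Lee, *Introduction to Riemannian Manifolds*, 2nd ed., GTM 176 (2018), Thm. 4.27 (c)–(d),
  Cor. 4.28. [LeeRiemannianManifolds2018]
* J. Sbierski, Ann. Henri Poincaré 17 (2016) 301–329 = arXiv:1309.7591v3, §3.2, proof of
  Thm. 12 (arXiv numbering). [Sbierski2016AHP]
-/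

noncomputable section

open Bundle Set Filter Function Topology
open scoped Manifold ContDiff Topology

namespace Literature.Geometry.Lorentzian

open Literature.Geometry.Riemannian

universe u

variable {E : Type u} [NormedAddCommGroup E] [NormedSpace ℝ E] {H : Type*} [TopologicalSpace H]
  {I : ModelWithCorners ℝ E H} {M : Type*} [TopologicalSpace M] [ChartedSpace H M]
  [IsManifold I ∞ M] [FiniteDimensional ℝ E]
  {cov : CovariantDerivative I E (TangentSpace I : M → Type _)}
  [CompleteSpace E] [T2Space M] [BoundarylessManifold I M]
  [CovariantDerivative.ContMDiffCovariantDerivative cov 1]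

/-- **A geodesic through a parameter `θ` is the maximal geodesic through its tangent lift at `θ`,
read at shifted times**: if `γ` is a geodesic of `cov` on `(0, b)` and `0 < θ < t₀ < b`, then
`t₀ - θ` lies in the domain of the maximal geodesic `γ_{p_θ}`, `p_θ = (γ θ, γ' θ)`, and
`(γ_{p_θ} (t₀ - θ), γ_{p_θ}' (t₀ - θ)) = (γ t₀, γ' t₀)` (translate `t ↦ γ (t + θ)`,
`IsGeodesicOn.comp_sub_const`, and maximality, `subset_maximalGeodesicDomain_of_isGeodesicOn`).
Lee 2018, Cor. 4.28; O'Neill 1983, Ch. 3, p. 68. [cite: LeeRiemannianManifolds2018, Cor. 4.28] -/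
theorem IsGeodesicOn.tangentLift_maximalGeodesic_tangentLift_sub {γ : ℝ → M} {b : ℝ}
    (hγ : IsGeodesicOn cov γ (Ioo 0 b)) {θ t₀ : ℝ} (hθ : 0 < θ) (hθt₀ : θ < t₀) (ht₀ : t₀ < b) :
    t₀ - θ ∈ maximalGeodesicDomain cov (tangentLift I γ θ).proj (tangentLift I γ θ).snd ∧
      tangentLift I (maximalGeodesic cov (tangentLift I γ θ).proj (tangentLift I γ θ).snd)
        (t₀ - θ) = tangentLift I γ t₀ := by
  -- the translate `t ↦ γ (t + θ)`, a geodesic on `(-θ, b - θ)` through `p_θ` at `0`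
  have hg₀ := hγ.comp_sub_const (-θ)
  have hpre : (fun t : ℝ ↦ t - (-θ)) ⁻¹' Ioo 0 b = Ioo (-θ) (b - θ) := by
    ext t
    simp only [mem_preimage, mem_Ioo, sub_neg_eq_add]
    constructor
    · rintro ⟨h1, h2⟩; exact ⟨by linarith, by linarith⟩
    · rintro ⟨h1, h2⟩; exact ⟨by linarith, by linarith⟩
  rw [hpre] at hg₀
  have h0 : (0 : ℝ) ∈ Ioo (-θ) (b - θ) := ⟨by linarith, by linarith⟩
  have hx : (fun t : ℝ ↦ γ (t - (-θ))) 0 = (tangentLift I γ θ).proj := by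
    simp only [zero_sub, neg_neg, tangentLift_proj]
  have hv : velocity I (fun t : ℝ ↦ γ (t - (-θ))) 0 = (tangentLift I γ θ).snd := by
    rw [velocity_comp_sub_const, tangentLift_snd, zero_sub, neg_neg]
  obtain ⟨hsub, -⟩ :=
    subset_maximalGeodesicDomain_of_isGeodesicOn isOpen_Ioo Set.ordConnected_Ioo h0 hg₀ hx hv
  have hmem : t₀ - θ ∈ Ioo (-θ) (b - θ) := ⟨by linarith, by linarith⟩
  refine ⟨hsub hmem, ?_⟩
  have htl := tangentLift_eqOn_maximalGeodesic_of_isGeodesicOn isOpen_Ioo Set.ordConnected_Ioo h0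
    hg₀ hx hv hmem
  rw [← htl, tangentLift_comp_sub_const, sub_neg_eq_add, sub_add_cancel]

/-- **One-sided uniqueness of geodesics from limiting initial data.** Let `γ` be a geodesic of the
`C¹` connection `cov` on the open interval `(0, b)` whose tangent lift `(γ t, γ' t)` converges to
`p₀ ∈ TM` as `t → 0⁺`, and suppose `(0, b)` is contained in the domain of the maximal geodesic
`γ_{p₀}`. Then `γ = γ_{p₀}` on `(0, b)`. (Nothing is assumed about `γ` at `0`.) Proof: for
`0 < θ < t₀ < b`, `(γ t₀, γ' t₀) = Θ(p_θ, t₀ - θ)` with `Θ` the maximal geodesic flow and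
`p_θ = (γ θ, γ' θ)` (`tangentLift_maximalGeodesic_tangentLift_sub`); let `θ → 0⁺` and use the
continuity of `Θ` on its open domain (`isOpen_continuousOn_tangentLift_maximalGeodesic`).
O'Neill 1983, Ch. 3, Lemma 22 and p. 70 (continuous dependence on initial conditions); Lee 2018,
Thm. 4.27 (d). [cite: ONeillSemiRiemannian1983, Ch. 3, Lemma 22 (p. 68) and p. 70] -/
theorem IsGeodesicOn.eqOn_maximalGeodesic_of_tendsto_tangentLift {γ : ℝ → M} {b : ℝ}
    (hγ : IsGeodesicOn cov γ (Ioo 0 b)) {p₀ : TangentBundle I M}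
    (hlim : Tendsto (tangentLift I γ) (𝓝[>] 0) (𝓝 p₀))
    (hb : Ioo 0 b ⊆ maximalGeodesicDomain cov p₀.proj p₀.snd) :
    EqOn γ (maximalGeodesic cov p₀.proj p₀.snd) (Ioo 0 b) := by
  haveI : T2Space (TangentBundle I M) := t2Space_totalSpace
  intro t₀ ht₀
  set Θ : TangentBundle I M × ℝ → TangentBundle I M :=
    fun q ↦ tangentLift I (maximalGeodesic cov q.1.proj q.1.snd) q.2 with hΘ
  set D : Set (TangentBundle I M × ℝ) :=
    {q | q.2 ∈ maximalGeodesicDomain cov q.1.proj q.1.snd} with hD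
  obtain ⟨hDo, hΘc⟩ := isOpen_continuousOn_tangentLift_maximalGeodesic (cov := cov) (I := I) (M := M)
  -- the flow identity for `θ ∈ (0, t₀)`
  have hkey : ∀ θ ∈ Ioo 0 t₀, Θ (tangentLift I γ θ, t₀ - θ) = tangentLift I γ t₀ := fun θ hθ ↦
    (hγ.tangentLift_maximalGeodesic_tangentLift_sub hθ.1 hθ.2 ht₀.2).2
  -- pass to the limit `θ → 0⁺`
  have hlim2 : Tendsto (fun θ : ℝ ↦ (tangentLift I γ θ, t₀ - θ)) (𝓝[>] 0) (𝓝 (p₀, t₀)) := by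
    refine hlim.prodMk_nhds ?_
    have h : Tendsto (fun θ : ℝ ↦ t₀ - θ) (𝓝 0) (𝓝 (t₀ - 0)) :=
      tendsto_const_nhds.sub tendsto_id
    rw [sub_zero] at h
    exact h.mono_left nhdsWithin_le_nhds
  have hmemD : (p₀, t₀) ∈ D := hb ht₀
  have hcont : ContinuousAt Θ (p₀, t₀) := hΘc.continuousAt (hDo.mem_nhds hmemD)
  have hT : Tendsto (fun θ : ℝ ↦ Θ (tangentLift I γ θ, t₀ - θ)) (𝓝[>] 0) (𝓝 (Θ (p₀, t₀))) :=
    hcont.tendsto.comp hlim2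
  have hconst : (fun θ : ℝ ↦ Θ (tangentLift I γ θ, t₀ - θ)) =ᶠ[𝓝[>] 0]
      fun _ ↦ tangentLift I γ t₀ := by
    filter_upwards [Ioo_mem_nhdsGT ht₀.1] with θ hθ using hkey θ hθ
  have heq : Θ (p₀, t₀) = tangentLift I γ t₀ :=
    tendsto_nhds_unique hT (tendsto_const_nhds.congr' hconst.symm)
  have h := congrArg TotalSpace.proj heq
  simp only [hΘ, tangentLift_proj] at h
  exact h.symm

/-- Under the hypotheses of `eqOn_maximalGeodesic_of_tendsto_tangentLift`, also the tangent
lifts agree on `(0, b)` (velocities only see germs). [cite: LeeRiemannianManifolds2018, Cor. 4.28] -/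
theorem IsGeodesicOn.tangentLift_eqOn_maximalGeodesic_of_tendsto_tangentLift {γ : ℝ → M} {b : ℝ}
    (hγ : IsGeodesicOn cov γ (Ioo 0 b)) {p₀ : TangentBundle I M}
    (hlim : Tendsto (tangentLift I γ) (𝓝[>] 0) (𝓝 p₀))
    (hb : Ioo 0 b ⊆ maximalGeodesicDomain cov p₀.proj p₀.snd) :
    EqOn (tangentLift I γ) (tangentLift I (maximalGeodesic cov p₀.proj p₀.snd)) (Ioo 0 b) := by
  intro t ht
  refine (tangentLift_congr_of_eventuallyEq (I := I) ?_).symm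
  filter_upwards [isOpen_Ioo.mem_nhds ht] with t' ht' using
    (hγ.eqOn_maximalGeodesic_of_tendsto_tangentLift hlim hb ht').symm

/-- **The endpoint value.** Under the hypotheses of `eqOn_maximalGeodesic_of_tendsto_tangentLift`,
if moreover `0 < b`, `b` lies in the domain of `γ_{p₀}` and `γ` is continuous from the left at
`b`, then `γ b = γ_{p₀} b` (both are the limit of `γ = γ_{p₀}` along `t → b⁻`).
[cite: ONeillSemiRiemannian1983, Ch. 3, Lemma 22 (p. 68) and p. 70] -/
theorem IsGeodesicOn.apply_eq_maximalGeodesic_of_tendsto_tangentLift {γ : ℝ → M} {b : ℝ}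
    (hb0 : 0 < b) (hγ : IsGeodesicOn cov γ (Ioo 0 b)) {p₀ : TangentBundle I M}
    (hlim : Tendsto (tangentLift I γ) (𝓝[>] 0) (𝓝 p₀))
    (hb : Ioo 0 b ⊆ maximalGeodesicDomain cov p₀.proj p₀.snd)
    (hbD : b ∈ maximalGeodesicDomain cov p₀.proj p₀.snd)
    (hcont : Tendsto γ (𝓝[<] b) (𝓝 (γ b))) :
    γ b = maximalGeodesic cov p₀.proj p₀.snd b := by
  obtain ⟨hmax, -, -, -⟩ := maximalGeodesic_spec' (cov := cov) p₀.proj p₀.snd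
  have hc2 : ContinuousAt (maximalGeodesic cov p₀.proj p₀.snd) b :=
    (IsGeodesicOn.mdifferentiableAt_holds hmax.isGeodesicOn hbD).continuousAt
  have hT2 : Tendsto (maximalGeodesic cov p₀.proj p₀.snd) (𝓝[<] b)
      (𝓝 (maximalGeodesic cov p₀.proj p₀.snd b)) :=
    hc2.tendsto.mono_left nhdsWithin_le_nhds
  have hev : γ =ᶠ[𝓝[<] b] maximalGeodesic cov p₀.proj p₀.snd := by
    filter_upwards [Ioo_mem_nhdsLT hb0] with t ht using
      hγ.eqOn_maximalGeodesic_of_tendsto_tangentLift hlim hb ht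
  exact tendsto_nhds_unique hcont (hT2.congr' hev.symm)

end Literature.Geometry.Lorentzian

end
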